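import Summits.QuantumFields.YangMills.Theorems.LuscherReductionTwistedTraceScalingBOStiffTensorPoincareSlack
import Summits.QuantumFields.YangMills.Theorems.TwistedTraceScaling.Negative.CensoredPoincareKilling
import Summits.QuantumFields.YangMills.Theorems.LuscherReductionTwistedTraceScalingMehlerTensor
import HarnessLib

/-!
# (B-ST) flat Poincaré, composition bricks (model-free): the killed transfer WITH a mass slack, and the tensorised inequality in product-measure form
# (lane A of S-BASE, crux `TwistedTraceScaling` stmt-QuantumFields-20203, C4-CORE, the (B-ST) pen; HANDOFF-g21 'REMAINING ANALYTIC ATOMS' composition, hand C `…-w3`)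

Two pieces of bookkeeping between ✓`…TensorPoincareSlack.variance_tensor_le_slack` (iterated integrals `dμ(y) dκ(z)`, weight `D_Y ⊗ D_Z`, a mass slack `δ_Y`) and the door's
`hflat` clause (one finite measure space `(X, ν)`, a censored jump kernel `J₀`, one mass slack):
* §1 ★★ `killed_transfer_door_slack` — R63 ✓`killed_transfer_door` for a global inequality that already carries a mass slack `δ`:
  `Var_X^D(g) ≤ P₀·½∫∫(δg)²J + δ∫g²D`, `g` supported in `S`, exit mass `∫_{Sᶜ}J(x,·) ≤ εD(x)` on `S` ⇒ `Var_S^D(g) ≤ P₀·½∫∫(δg)²J₀ + (P₀ε + δ)·∫_S g²D`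
  (`J₀ = J` censored to `S × S`; uses R63's `setVariance_le_variance`, `jumpForm_eq_censored_add_killing`, `censoredForm_eq`);
* §2 `productWeight_moments` — `∫ G²(D_Y⊗D_Z) d(μ⊗κ) = ∫ D_Y(∫G(y,·)²D_Z dκ)dμ`, first moment, `∫D_Y⊗D_Z = ∫D_Y∫D_Z`; ★ `productJump_eq` — for the resampling kernel
  `J_flat(p,q) = J(p₁,q₁)·D_Z(p₂)D_Z(q₂)/M`: `∫∫(G(p)−G(q))²J_flat d(μ⊗κ)² = (1/M)·∫∫J(y,y')(∫∫(G(y,z)−G(y',z'))²D_ZD_Z' dκ²)dμ²` (the shuffle `((y,z),(y',z')) ↦ ((y,y'),(z,z'))` is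
  measure preserving, ✓`…MehlerTensor.measurePreserving_shuffle`).
Consumed by `…BOStiffFlatPoincare.flat_poincare` (X = `ℝ^σ × Z`, `μ = dy|_{[−R,R]^σ}`, Mehler pair ⊗ gauge resampling).
HONEST FRAMING: measure-theoretic bookkeeping for a stub of a child of the CONDITIONAL route R2b1; (B-ST) OPEN; C4-CORE OPEN; not infinite volume, not a gap, not Clay.

## References
* M. Fukushima, Y. Oshima, M. Takeda, *Dirichlet Forms and Symmetric Markov Processes*, de Gruyter 2011, §4.4 (part process, killing measure). [FukushimaOshimaTakeda2011]
-/

set_option autoImplicit false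

noncomputable section

open MeasureTheory Filter
open scoped Real

namespace Summit.QuantumFields.YangMills.Theorems.FemtoTransferGap.StiffDoor

/-! ## §1 The killed transfer carrying a mass slack (model-free; R63 `killed_transfer_door` + slack) -/

section KilledSlack

open Summit.QuantumFields.YangMills.Theorems.TwistedTraceScaling.Negative.R63

variable {X : Type*} [MeasurableSpace X] {μ : Measure X} [IsFiniteMeasure μ]
variable {J J₀ : X → X → ℝ} {g D : X → ℝ} {CJ Cg CD : ℝ} {S : Set X} {P₀ ε δ : ℝ}

/-- ★★ **Killed transfer with a mass slack.**  Finite measure, bounded measurable symmetric `J`, bounded measurable `g` supported in the measurable `S`, bounded measurable `D ≥ 0` with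
`∫_S D > 0`, `P₀ ≥ 0`; `J₀` the kernel censored to `S × S`; EXIT MASS `∫_{Sᶜ} J(x,·) ≤ ε·D(x)` on `S`; and a GLOBAL inequality that already carries a mass slack `δ`:
`Var_X^D(g) ≤ P₀·½∫∫(g(x)−g(y))²J + δ·∫ g²D`.  Then `Var_S^D(g) ≤ P₀·½∫∫(g(x)−g(y))²J₀ + (P₀ε + δ)·∫_S g²D` (R63 `killed_transfer_door` is `δ = 0`).
[cite: FukushimaOshimaTakeda2011, §4.4] -/
theorem killed_transfer_door_slack (hJ : Measurable (Function.uncurry J)) (hJb : ∀ x y, |J x y| ≤ CJ) (hsymm : ∀ x y, J x y = J y x)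
    (hg : Measurable g) (hgb : ∀ x, |g x| ≤ Cg) (hgS : ∀ x, x ∉ S → g x = 0) (hS : MeasurableSet S)
    (hD : Measurable D) (hDb : ∀ x, |D x| ≤ CD) (hD0 : ∀ x, 0 ≤ D x) (hZS : 0 < ∫ x in S, D x ∂μ) (hP₀ : 0 ≤ P₀)
    (hin : ∀ x ∈ S, ∀ y ∈ S, J₀ x y = J x y) (hout : ∀ x y, x ∉ S ∨ y ∉ S → J₀ x y = 0)
    (hκ : ∀ x ∈ S, ∫ y in Sᶜ, J x y ∂μ ≤ ε * D x)
    (hglob : (∫ x, g x ^ 2 * D x ∂μ) - (∫ x, g x * D x ∂μ) ^ 2 / (∫ x, D x ∂μ) ≤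
      P₀ * ((1 / 2) * ∫ x, ∫ y, (g x - g y) ^ 2 * J x y ∂μ ∂μ) + δ * ∫ x, g x ^ 2 * D x ∂μ) :
    (∫ x in S, g x ^ 2 * D x ∂μ) - (∫ x in S, g x * D x ∂μ) ^ 2 / (∫ x in S, D x ∂μ) ≤
      P₀ * ((1 / 2) * ∫ x, ∫ y, (g x - g y) ^ 2 * J₀ x y ∂μ ∂μ) + (P₀ * ε + δ) * ∫ x in S, g x ^ 2 * D x ∂μ := by
  -- restrict the variance, split the global jump form, identify the censored form
  have hvar := setVariance_le_variance (μ := μ) hD hDb hD0 hgS hZS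
  have hsplit := jumpForm_eq_censored_add_killing (μ := μ) hJ hJb hsymm hg hgb hgS hS
  have hcens := censoredForm_eq (μ := μ) (g := g) hin hout hS
  have eS : ∫ x, g x ^ 2 * D x ∂μ = ∫ x in S, g x ^ 2 * D x ∂μ :=
    (setIntegral_eq_integral_of_forall_compl_eq_zero fun x hx => by simp [hgS x hx]).symm
  -- the killing term
  obtain ⟨hκm, hκb⟩ := killingDensity_bdd (μ := μ) hJ hJb S
  have i1 : Integrable (fun x => g x ^ 2 * ∫ y in Sᶜ, J x y ∂μ) (μ.restrict S) :=
    integrable_of_measurable_abs_le (μ.restrict S) ((hg.pow_const 2).mul hκm) (C := Cg ^ 2 * (CJ * (μ.restrict Sᶜ).real Set.univ)) fun x => by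
      rw [abs_mul, abs_pow]
      exact mul_le_mul (pow_le_pow_left₀ (abs_nonneg _) (hgb x) 2) (hκb x) (abs_nonneg _) (sq_nonneg _)
  have i2 : Integrable (fun x => g x ^ 2 * (ε * D x)) (μ.restrict S) :=
    integrable_of_measurable_abs_le (μ.restrict S) ((hg.pow_const 2).mul (hD.const_mul ε)) (C := Cg ^ 2 * (|ε| * CD)) fun x => by
      rw [abs_mul, abs_pow, abs_mul]
      exact mul_le_mul (pow_le_pow_left₀ (abs_nonneg _) (hgb x) 2) (mul_le_mul_of_nonneg_left (hDb x) (abs_nonneg _))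
        (mul_nonneg (abs_nonneg _) (abs_nonneg _)) (sq_nonneg _)
  have hk : ∫ x in S, g x ^ 2 * (∫ y in Sᶜ, J x y ∂μ) ∂μ ≤ ε * ∫ x in S, g x ^ 2 * D x ∂μ := by
    have h1 : ∫ x in S, g x ^ 2 * (∫ y in Sᶜ, J x y ∂μ) ∂μ ≤ ∫ x in S, g x ^ 2 * (ε * D x) ∂μ :=
      setIntegral_mono_on i1 i2 hS fun x hx => mul_le_mul_of_nonneg_left (hκ x hx) (sq_nonneg _)
    have e : ∫ x in S, g x ^ 2 * (ε * D x) ∂μ = ε * ∫ x in S, g x ^ 2 * D x ∂μ := by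
      rw [← integral_const_mul]; exact integral_congr_ae (ae_of_all _ fun x => by ring)
    linarith [e]
  -- assemble
  rw [hsplit, ← hcens, eS] at hglob
  have hk' := mul_le_mul_of_nonneg_left hk hP₀
  have e2 : P₀ * ((1 / 2) * ∫ x, ∫ y, (g x - g y) ^ 2 * J₀ x y ∂μ ∂μ + ∫ x in S, g x ^ 2 * (∫ y in Sᶜ, J x y ∂μ) ∂μ) =
      P₀ * ((1 / 2) * ∫ x, ∫ y, (g x - g y) ^ 2 * J₀ x y ∂μ ∂μ) + P₀ * ∫ x in S, g x ^ 2 * (∫ y in Sᶜ, J x y ∂μ) ∂μ := by ring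
  rw [e2] at hglob
  linarith [hvar, hglob, hk']

end KilledSlack

/-! ## §2 The tensorised inequality in product-measure form (model-free Fubini bookkeeping) -/

section ProductForm

open Summit.QuantumFields.YangMills.Theorems.FemtoTransferGap.Mehler

variable {Y Z : Type*} [MeasurableSpace Y] [MeasurableSpace Z] {μ : Measure Y} {κ : Measure Z} [IsFiniteMeasure μ] [IsFiniteMeasure κ]
variable {DY : Y → ℝ} {DZ : Z → ℝ} {J : Y → Y → ℝ} {G : Y × Z → ℝ} {CY CZ CJ CG : ℝ}

/-- Moments of the product weight `D_Y ⊗ D_Z` in product-measure form: `∫ G²·(D_Y⊗D_Z) d(μ⊗κ) = ∫ D_Y(y)·(∫ G(y,·)²D_Z dκ) dμ`, the same for the first moment, and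
`∫ D_Y⊗D_Z = ∫D_Y·∫D_Z`. [folklore] -/
theorem productWeight_moments (hDY : Measurable DY) (hDYb : ∀ y, |DY y| ≤ CY) (hDZ : Measurable DZ) (hDZb : ∀ z, |DZ z| ≤ CZ)
    (hG : Measurable G) (hGb : ∀ p, |G p| ≤ CG) :
    (∫ p, G p ^ 2 * (DY p.1 * DZ p.2) ∂(μ.prod κ) = ∫ y, DY y * ∫ z, G (y, z) ^ 2 * DZ z ∂κ ∂μ) ∧
    (∫ p, G p * (DY p.1 * DZ p.2) ∂(μ.prod κ) = ∫ y, DY y * ∫ z, G (y, z) * DZ z ∂κ ∂μ) ∧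
    (∫ p, DY p.1 * DZ p.2 ∂(μ.prod κ) = (∫ y, DY y ∂μ) * ∫ z, DZ z ∂κ) := by
  have hDm : Measurable fun p : Y × Z => DY p.1 * DZ p.2 := (hDY.comp measurable_fst).mul (hDZ.comp measurable_snd)
  have hDb : ∀ p : Y × Z, |DY p.1 * DZ p.2| ≤ CY * CZ := fun p => by
    rw [abs_mul]; exact mul_le_mul (hDYb p.1) (hDZb p.2) (abs_nonneg _) ((abs_nonneg _).trans (hDYb p.1))
  have i2 : Integrable (fun p : Y × Z => G p ^ 2 * (DY p.1 * DZ p.2)) (μ.prod κ) :=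
    integrable_of_measurable_abs_le (μ.prod κ) ((hG.pow_const 2).mul hDm) (C := CG ^ 2 * (CY * CZ)) fun p => by
      rw [abs_mul, abs_pow]; exact mul_le_mul (pow_le_pow_left₀ (abs_nonneg _) (hGb p) 2) (hDb p) (abs_nonneg _) (sq_nonneg _)
  have i1 : Integrable (fun p : Y × Z => G p * (DY p.1 * DZ p.2)) (μ.prod κ) :=
    integrable_of_measurable_abs_le (μ.prod κ) (hG.mul hDm) (C := CG * (CY * CZ)) fun p => by
      rw [abs_mul]; exact mul_le_mul (hGb p) (hDb p) (abs_nonneg _) ((abs_nonneg _).trans (hGb p))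
  refine ⟨?_, ?_, integral_prod_mul (μ := μ) (ν := κ) DY DZ⟩
  · rw [integral_prod _ i2]
    refine integral_congr_ae (ae_of_all _ fun y => ?_)
    dsimp only
    rw [← integral_const_mul]
    exact integral_congr_ae (ae_of_all _ fun z => by ring)
  · rw [integral_prod _ i1]
    refine integral_congr_ae (ae_of_all _ fun y => ?_)
    dsimp only
    rw [← integral_const_mul]
    exact integral_congr_ae (ae_of_all _ fun z => by ring)

/-- ★ **The product jump form is the tensorised jump form**: for the resampling kernel `J(y,y')·D_Z(z)D_Z(z')/M` on `Y × Z`,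
`∫∫ (G(p)−G(q))²·J(p₁,q₁)D_Z(p₂)D_Z(q₂)/M d(μ⊗κ)² = (1/M)·∫∫ J(y,y')·(∫∫ (G(y,z)−G(y',z'))² D_Z(z)D_Z(z') dκ²) dμ²` (the shuffle `((y,z),(y',z')) ↦ ((y,y'),(z,z'))`
is measure preserving, ✓`…MehlerTensor.measurePreserving_shuffle`). [folklore] -/
theorem productJump_eq (hDZ : Measurable DZ) (hDZb : ∀ z, |DZ z| ≤ CZ) (hJ : Measurable (Function.uncurry J)) (hJb : ∀ y y', |J y y'| ≤ CJ)
    (hG : Measurable G) (hGb : ∀ p, |G p| ≤ CG) (M : ℝ) :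
    ∫ p, ∫ q, (G p - G q) ^ 2 * (J p.1 q.1 * (DZ p.2 * DZ q.2 / M)) ∂(μ.prod κ) ∂(μ.prod κ) =
      (1 / M) * ∫ y, ∫ y', J y y' * (∫ z, ∫ z', (G (y, z) - G (y', z')) ^ 2 * (DZ z * DZ z') ∂κ ∂κ) ∂μ ∂μ := by
  -- the integrand on `(Y×Z)²` and its shuffle on `Y²×Z²`
  set F : (Y × Z) × (Y × Z) → ℝ := fun pq => (G pq.1 - G pq.2) ^ 2 * (J pq.1.1 pq.2.1 * (DZ pq.1.2 * DZ pq.2.2 / M)) with hF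
  set H : (Y × Y) × (Z × Z) → ℝ := fun w => (G (w.1.1, w.2.1) - G (w.1.2, w.2.2)) ^ 2 * (J w.1.1 w.1.2 * (DZ w.2.1 * DZ w.2.2 / M)) with hH
  have hHF : H ∘ shuffle Y Z = F := by
    funext pq; rfl
  have hJ2 : Measurable fun pq : (Y × Z) × (Y × Z) => J pq.1.1 pq.2.1 := hJ.comp (measurable_fst.fst.prodMk measurable_snd.fst)
  have hFm : Measurable F :=
    (((hG.comp measurable_fst).sub (hG.comp measurable_snd)).pow_const 2).mul
      (hJ2.mul (((hDZ.comp measurable_fst.snd).mul (hDZ.comp measurable_snd.snd)).div_const M))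
  have hFb : ∀ pq, |F pq| ≤ (2 * CG) ^ 2 * (CJ * (CZ * CZ / |M|)) := fun pq => by
    rw [hF]; dsimp only
    rw [abs_mul, abs_pow, abs_mul, abs_div, abs_mul]
    have h1 : |G pq.1 - G pq.2| ≤ 2 * CG := (abs_sub _ _).trans (by linarith [hGb pq.1, hGb pq.2])
    have hCJ : 0 ≤ CJ := (abs_nonneg _).trans (hJb pq.1.1 pq.2.1)
    refine mul_le_mul (pow_le_pow_left₀ (abs_nonneg _) h1 2) (mul_le_mul (hJb _ _) ?_ (by positivity) hCJ) (by positivity) (sq_nonneg _)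
    exact div_le_div_of_nonneg_right (mul_le_mul (hDZb _) (hDZb _) (abs_nonneg _) ((abs_nonneg _).trans (hDZb pq.1.2))) (abs_nonneg _)
  have hFi : Integrable F ((μ.prod κ).prod (μ.prod κ)) := integrable_of_measurable_abs_le _ hFm hFb
  have hsh := measurePreserving_shuffle (ν := μ) κ
  have hHi : Integrable H ((μ.prod μ).prod (κ.prod κ)) := by
    rw [← hsh.integrable_comp_emb (shuffle Y Z).measurableEmbedding, hHF]; exact hFi
  -- `∫∫ F = ∫ H`
  have h1 : ∫ p, ∫ q, (G p - G q) ^ 2 * (J p.1 q.1 * (DZ p.2 * DZ q.2 / M)) ∂(μ.prod κ) ∂(μ.prod κ) = ∫ w, H w ∂((μ.prod μ).prod (κ.prod κ)) := by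
    rw [← integral_prod _ hFi, ← hsh.integral_comp', ← hHF]
    rfl
  rw [h1, integral_prod _ hHi]
  -- the inner `(z,z')`-integral at a.e. `(y,y')`
  have hae : ∀ᵐ yy ∂(μ.prod μ), ∫ zz, H (yy, zz) ∂(κ.prod κ) = (1 / M) * (J yy.1 yy.2 * ∫ z, ∫ z', (G (yy.1, z) - G (yy.2, z')) ^ 2 * (DZ z * DZ z') ∂κ ∂κ) := by
    filter_upwards [hHi.prod_right_ae] with yy hyy
    rw [integral_prod _ hyy, ← integral_const_mul, ← integral_const_mul]
    refine integral_congr_ae (ae_of_all _ fun z => ?_)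
    dsimp only
    rw [← integral_const_mul, ← integral_const_mul]
    refine integral_congr_ae (ae_of_all _ fun z' => ?_)
    dsimp only [hH]
    ring
  rw [integral_congr_ae hae, integral_prod _ (hHi.integral_prod_left.congr hae), ← integral_const_mul]
  refine integral_congr_ae (ae_of_all _ fun y => ?_)
  dsimp only
  rw [← integral_const_mul]

end ProductForm

end Summit.QuantumFields.YangMills.Theorems.FemtoTransferGap.StiffDoor

end
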